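import Mathlib
import HarnessLib
import Summits.AtomisticToContinuum.FouriersLaw.Theses.JunctionLocality
import Summits.AtomisticToContinuum.FouriersLaw.Theses.FeketeSeriesLaw

/-!
# Strategy census for crux `JunctionLocality.ConductanceLowerBound` (stmt-AtomisticToContinuum-11749) —
typed companions of `STRATEGY-CENSUS.md` (crux-strategist seat `cstrat-stmt-AtomisticToContinuum-11749-s1`, 2026-08-17)

This file only TYPES the statements named in the census (strengthenings `S⁺`, the pieces of the
candidate decompositions, and the bath-free obstruction to local certificates) over the existing
declarations, and proves the two elementary implications that the census quotes.  Nothing here is a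
line: no `stub_*`, no composition to the crux is registered (the live skeleton
`Lines/ForecastSensitivitySketch.lean` of lead c3 is untouched).

Contents
* §1 `MonotoneResponse` (census S2) and `conductanceLowerBound_of_monotoneResponse`
  (`MonotoneResponse → PositiveConductance → ConductanceLowerBound`, proved).
* §2 `NotInsulator` (census D-B; = `Disproof.NotInsulator`, restated so that this file does not
  import the crux workfile) and the trivial direction `ConductanceLowerBound → NotInsulator`.
  The converse under (A)+(P) is `Disproof.crux_of_notInsulator` (crux workfile `Disproof.lean` §5).
* §3 `BathFreeKineticStep` (census S3 / Negation): at `γ = 0` the 3-chain carries currentless weak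
  steady states with a strict kinetic-temperature step — statement with the explicit witness in the
  docstring (proof = push-forward of the 1-site Gibbs measure along the antisymmetric invariant
  plane; not carried out here).
* §4 `LocalKineticOhmLaw` (census S3): the hypothesis of the landed reduction
  `KickDipoleNoCollapse.conductanceLowerBound_of_localOhmLowerBound`, bound to a name.
-/

noncomputable section

open MeasureTheory Filter Topology
open Literature.MathematicalPhysics.KineticTheory.HeatConduction

namespace Summit.AtomisticToContinuum.FouriersLaw.Cruxes.ConductanceLowerBound.StrategyCensus

open Summit.AtomisticToContinuum.FouriersLaw.Theses.JunctionLocality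

/-! ## §1 Strengthening S2: eventual monotonicity of the response sequence -/

/-- **S2 — MONOTONE RESPONSE** (census §Strengthen, S2).  In the crux frame (uniqueness antecedent,
steady-state family, `T > 0`, response coefficients `D`): `D_N ≤ D_{N+1}` for all `N ≥ 2`.
Equivalent to `𝒯_{N+1}/𝒯_N ≥ 1 − 1/N` for the relative transmission `𝒯_N = 2 D_N /(γ (N−1))`,
i.e. the floor with ZERO slack (any defect `1 − C/N`, `C > 1`, yields only `D_N ≥ c·N^{1−C}`).
True at the harmonic corner (`D_N = (N−1)c_N` increasing); no sign principle is known for the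
anharmonic chain (it compares a Markov Langevin contact with a one-oscillator-dressed contact). -/
def MonotoneResponse : Prop :=
  ∀ ω₂ lam β γ : ℝ, 0 < ω₂ → 0 < lam → 0 < β → 0 < γ →
    (∀ (N : ℕ) (T_L T_R : ℝ), 0 < T_L → 0 < T_R → ∀ μ ν : Measure (PhaseSpace N),
      (pinnedChain ω₂ lam β γ).IsSteadyState N T_L T_R μ →
      (pinnedChain ω₂ lam β γ).IsSteadyState N T_L T_R ν → μ = ν) →
    ∀ μ : (N : ℕ) → ℝ → ℝ → Measure (PhaseSpace N),
      (∀ (N : ℕ) (T_L T_R : ℝ), 0 < T_L → 0 < T_R →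
        (pinnedChain ω₂ lam β γ).IsSteadyState N T_L T_R (μ N T_L T_R)) →
      ∀ T : ℝ, 0 < T → ∀ D : ℕ → ℝ,
        (∀ N : ℕ, Tendsto (fun δ : ℝ =>
          (pinnedChain ω₂ lam β γ).totalCurrent (μ N (T + δ / 2) (T - δ / 2)) / δ)
            (𝓝[≠] 0) (𝓝 (D N))) →
        ∀ N : ℕ, 2 ≤ N → D N ≤ D (N + 1)

/-- **`MonotoneResponse → PositiveConductance → ConductanceLowerBound`** (census S2: the
strengthening does imply the crux; `PositiveConductance` is the CLOSED item stmt-11750).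
Proof: `c := D 2 > 0` and `D 2 ≤ D N` for `N ≥ 2` by induction. -/
theorem conductanceLowerBound_of_monotoneResponse
    (hM : MonotoneResponse) (hP : PositiveConductance) : ConductanceLowerBound := by
  intro ω₂ lam β γ hω hl hβ hγ huniq μ hμ T hT D hD
  have hpos : ∀ N : ℕ, 2 ≤ N → 0 < D N := hP ω₂ lam β γ hω hl hβ hγ huniq μ hμ T hT D hD
  have hmono : ∀ N : ℕ, 2 ≤ N → D N ≤ D (N + 1) := hM ω₂ lam β γ hω hl hβ hγ huniq μ hμ T hT D hD
  refine ⟨D 2, hpos 2 le_rfl, 2, fun N hN => ?_⟩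
  induction N, hN using Nat.le_induction with
  | base => exact le_rfl
  | succ n hn ih => exact ih.trans (hmono n hn)

/-! ## §2 Decomposition D-B: the in-route residual `NotInsulator` -/

/-- **NOT AN INSULATOR** (census D-B; verbatim the conclusion-weakening `limsup_N D_N > 0` of the
crux, = `Disproof.NotInsulator`).  Under the route's bet (A) `SuperadditiveResistance` and the closed
(P) `PositiveConductance` it is EQUIVALENT to the crux (`Disproof.crux_iff_notInsulator`), so inside
route JunctionLocality the crux's residual content beyond (A) is exactly this statement. -/
def NotInsulator : Prop :=
  ∀ ω₂ lam β γ : ℝ, 0 < ω₂ → 0 < lam → 0 < β → 0 < γ →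
    (∀ (N : ℕ) (T_L T_R : ℝ), 0 < T_L → 0 < T_R → ∀ μ ν : Measure (PhaseSpace N),
      (pinnedChain ω₂ lam β γ).IsSteadyState N T_L T_R μ →
      (pinnedChain ω₂ lam β γ).IsSteadyState N T_L T_R ν → μ = ν) →
    ∀ μ : (N : ℕ) → ℝ → ℝ → Measure (PhaseSpace N),
      (∀ (N : ℕ) (T_L T_R : ℝ), 0 < T_L → 0 < T_R →
        (pinnedChain ω₂ lam β γ).IsSteadyState N T_L T_R (μ N T_L T_R)) →
      ∀ T : ℝ, 0 < T → ∀ D : ℕ → ℝ,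
        (∀ N : ℕ, Tendsto (fun δ : ℝ =>
          (pinnedChain ω₂ lam β γ).totalCurrent (μ N (T + δ / 2) (T - δ / 2)) / δ)
            (𝓝[≠] 0) (𝓝 (D N))) →
        ∃ c : ℝ, 0 < c ∧ ∀ N₀ : ℕ, ∃ N : ℕ, N₀ ≤ N ∧ c ≤ D N

/-- The crux implies non-insulation (eventually ⇒ frequently). -/
theorem notInsulator_of_conductanceLowerBound (h : ConductanceLowerBound) : NotInsulator := by
  intro ω₂ lam β γ hω hl hβ hγ huniq μ hμ T hT D hD
  obtain ⟨c, hc, N₁, hN₁⟩ := h ω₂ lam β γ hω hl hβ hγ huniq μ hμ T hT D hD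
  exact ⟨c, hc, fun N₀ => ⟨max N₀ N₁, le_max_left _ _, hN₁ _ (le_max_right _ _)⟩⟩

/-! ## §3 Negation / S3: the bath-free kinetic step (obstruction to LOCAL certificates) -/

/-- **BATH-FREE KINETIC STEP** (census S3 and §Negation).  With the baths switched off (`γ = 0`;
`lam, β ≥ 0` arbitrary, so the anharmonic chain is included) the 3-chain has, for every nominal
temperature pair, a weak steady state (all `∫ L f dμ = 0`, integrable currents) that carries NO
current through any bond but has a STRICT kinetic-temperature step `∫ p_0² dμ > ∫ p_1² dμ`.
Witness: the plane `S = {q_1 = p_1 = 0, q_2 = −q_0, p_2 = −p_0}` is invariant under the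
Hamiltonian flow (`U`, `V` even ⇒ the force on site 1 vanishes on `S` and the forces on sites 0, 2
are opposite), the flow on `S` is the one-site system `h = p²/2 + U(q) + V(q)`, and the push-forward
of `e^{−h/T} dq dp` (normalised) along `(q,p) ↦ ((q,0,−q),(p,0,−p))` is a weak steady state of the
bath-free 3-chain (chain rule + the 1-site case of `Disproof.isSteadyState_gibbs_gamma_zero`),
with `∫ p_0² = T`, `∫ p_1² = 0`, and all bond currents odd in `p`.  CONSEQUENCE: no inequality of
local-Ohm type `c·(⟨p_i²⟩ − ⟨p_{i+1}²⟩) ≤ ⟨j_i⟩` can be certified from bulk stationarity identities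
`∫ A f dμ = 0` (f supported away from the baths) plus positivity alone — every such certificate
would apply verbatim to this measure (embedded in the interior of a long chain at rest outside the
block), where the left side is `c·T > 0` and the right side is `0`.  A proof of `LocalKineticOhmLaw`
must therefore use `γ > 0` quantitatively at interior bonds, i.e. hypoelliptic smoothing at distance
`≍ N/2` from the baths (barrier `SpectralGapClosing`). -/
def BathFreeKineticStep : Prop :=
  ∀ ω₂ lam β T : ℝ, 0 < ω₂ → 0 ≤ lam → 0 ≤ β → 0 < T → ∀ T_L T_R : ℝ,
    ∃ μ : Measure (PhaseSpace 3), (pinnedChain ω₂ lam β 0).IsSteadyState 3 T_L T_R μ ∧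
      (∀ i : Fin 3, ∫ x, (pinnedChain ω₂ lam β 0).bondCurrent 3 i x ∂μ = 0) ∧
      ∫ x, x.2 (1 : Fin 3) ^ 2 ∂μ < ∫ x, x.2 (0 : Fin 3) ^ 2 ∂μ

/-! ## §4 Strengthening S3: the local kinetic Ohm law (hypothesis of the landed reduction) -/

/-- **S3 — LOCAL KINETIC OHM LAW at finite bias** (census S3; verbatim the hypothesis of the landed
`KickDipoleNoCollapse.conductanceLowerBound_of_localOhmLowerBound`, p100874): at every interior bond
of the NESS the current is at least `c` times the kinetic-temperature drop, `c = c(params, T)`,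
for all small positive biases.  Strictly STRONGER than the crux (it gives `D_N ≥ c/(1+2c/γ)` for
every `N ≥ 2`); FALSE for bath-free weak steady states (`BathFreeKineticStep`), so its proof cannot
be a local certificate. -/
def LocalKineticOhmLaw : Prop :=
  ∀ ω₂ lam β γ : ℝ, 0 < ω₂ → 0 < lam → 0 < β → 0 < γ → ∀ T : ℝ, 0 < T →
    ∃ c : ℝ, 0 < c ∧ ∀ N : ℕ, 2 ≤ N → ∃ δ₀ : ℝ, 0 < δ₀ ∧ ∀ δ : ℝ, 0 < δ → δ < δ₀ →
      ∀ μ : Measure (PhaseSpace N), (pinnedChain ω₂ lam β γ).IsSteadyState N (T + δ / 2) (T - δ / 2) μ →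
        ∀ (i : Fin N) (hi : i.val + 1 < N),
          c * ((∫ x, x.2 i ^ 2 ∂μ) - ∫ x, x.2 ⟨i.val + 1, hi⟩ ^ 2 ∂μ) ≤
            ∫ x, (pinnedChain ω₂ lam β γ).bondCurrent N i x ∂μ

/-! ## §5 Decomposition D-A: the series-law supplier (items of route FeketeSeriesLaw) -/

/-- Census D-A, typed: the crux from the SUBadditive series law (stmt-14041, open, strictly stronger:
it excludes insulation at the junction scale) and fixed-`N` positivity (stmt-11750, closed).  The
implication is elementary real analysis (`R_N := (N−1)/D_N` quasi-subadditive and positive ⇒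
`R_N ≤ K·N` ⇒ `D_N ≥ 1/(2K)`); proved in the refuter's item evidence `Reduction.lean`
(2026-08-15T22:33Z) — recorded here as a `Prop`-level statement of the split, not re-proved. -/
def SeriesLawSplit : Prop :=
  Summit.AtomisticToContinuum.FouriersLaw.Theses.FeketeSeriesLaw.QuasiSubadditiveResistance →
    PositiveConductance → ConductanceLowerBound

end Summit.AtomisticToContinuum.FouriersLaw.Cruxes.ConductanceLowerBound.StrategyCensus

end
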